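import Summits.QuantumFields.YangMills.Theorems.BalabanUVNodesN15BackwardShift
import Summits.QuantumFields.YangMills.Theorems.BalabanUVNodesN15DefectKernelBDHk163
import HarnessLib

/-!
# Route «BalabanUVNodes» (K4 «SpineRates»), node N15 = NE2 — THE BACKWARD DERIVATIVE PIECES OF THE U = 1 VECTOR SINGLE-SCALE PIECE: plain block majorants
# and the η-RATE of `∇⁻_νG = S_{−ν}∂_νG`, `∇⁻_μG∂_ν* = S_{−μ}∂_μG∂_ν*` THROUGH KING's FLOOR PAIRING, one uniform `(β, δ, m₀)` on the sized carriers

Cell `pub-ymgap`, seat `pub-ymgap-dag-n15-c` (generation g3; R134 ACCELERATION SEAT, strategy s1 «first missing estimate»; HUMAN RULING D-0062; chair R424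
venue; `bears_on: R4∕N15`).  Filed `--supports stmt-QuantumFields-19908 --as helper` (K3′; helper).  THEOREMS ONLY; imports BY NAME, nothing in the tree
modified: this seat's `…N15BackwardShift` (`bshiftV`, `pieceD1b`, `pieceMb`, `hasMaj_bshiftV_comp`, `hasMaj_idefShift_comp`,
`tdistT_blockOf_sub_unitVec_le`), `T4EtaRateDefect.idef_comp` (Leibniz) and `…N15DefectKernelBDHk163` (`abs_reD_single_sub_bshift_le`, `exp_neg_min_le`, `CHD_third_nonneg`); through them n15-a
parts 15∕16∕26 (`entry1_eq_idef`, `hasMaj_threeEntries`, `hasMaj_plain_all`, `hasMaj_plain_unitTorus`, `abs_reH_single_le`, `abs_reD_single_le`,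
`exists_abs_covC_single_le`, `fineBond_weight_balance`, `blkFine_comp_kingPrV`) and this seat's g0 `…N15VectorPieceMixed` (`hasMaj_mixedEntries`,
`hasMaj_plainMixed_all`), `…N15VectorPieceBackground` (`unitTorusGeoS`, `thetaV`, `VecIndexS`).

WHAT.  The `U ≡ 1` LETTERS OF THE BACKWARD PIECES that `…N15BackgroundV1ByName.ne2PlusOperator_v1` (the print's own `V′₁(A)` of [B9] (3.52), both bond
orientations) displays as hypotheses on the `inr` half of the forward∕backward stack: (a) PLAIN majorants `β·e^{−ρ|y−y′|_T}` of `∇⁻_μG` (coarse and fine) and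
of `∇⁻_μG∂_ν*` (coarse) — the landed forward majorants shifted one unit block (`hasMaj_bshiftV_comp`, factor `e^{ρ}`); (b) the η-DEFECTS through King's pairing,
`𝔇(S′_{−μ}P′, S_{−μ}P) = S′_{−μ}∘𝔇(P′, P) + 𝔇(S′_{−μ}, S_{−μ})∘P` (`idef_comp`): the first term is the landed forward entry (n15-a part 16 `entry1`, g0's mixed
`hasMaj_mixedEntries`) shifted one block; the second is majorised by ANY majorant of the one-step difference `(1 − S_{−μ})P = ((1 − S_{−μ})∂_μH_k)·C^{(k)}·(w·Bᵀ)`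
(`hasMaj_idefShift_comp`), a piece-shaped composite whose LEFT factor is HÖLDER-SMALL WITH DECAY (`abs_reD_single_sub_bshift_le`: `CHD(d,⅓)·(L^k)^{−⅓}·e^{δ_H∕2}·
e^{−(δ_H∕2)d}`), fed to part 26's three-factor lemma `hasMaj_plain_unitTorus`.  Rate: `(L^k)^{−min(α,γ)∕2}` from the forward entry and `(L^k)^{−⅓}` from the
Hölder step — collected at the former when `min(α,γ) ≤ ⅔` (`one_div_rpow_third_le`); the sized layer reads it at `α = γ = ½`, `θ_j = (L^k)^{−¼}`.

CONTENTS.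
* §1 **`hasMaj_plainBackward_all`**: one `(β, δ_p)` for coarse `∇⁻_μG`, fine `∇⁻′_μG′`, coarse `∇⁻_μG∂_ν*`, every unit torus `Π ℤ∕M_ν` (`L ∣ M_ν`), all `k, m, μ, ν`,
  `0 ≤ ρ ≤ δ_p`.
* §2 `one_div_rpow_third_le`, `backward_sum_le` (arithmetic); **`hasMaj_backwardEntries`**: one `(B, δ₀)` such that for all `M, k, m ≥ 1, μ, ν`, `0 ≤ ρ ≤ δ₀`,
  `𝔇(∇⁻′_μG′, ∇⁻_μG)` and `𝔇(∇⁻′_μG′∂′_ν*, ∇⁻_μG∂_ν*)` have the block majorant `B·(L^k)^{−min(α,γ)∕2}·e^{−ρ|y−y′|_T}` (`0 ≤ α < 1`, `0 < γ < 1`, `min(α,γ) ≤ ⅔`).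
* §3 **`uniform_layer_backward`**: on the sized carriers `unitTorusGeoS L j.k j.Mn j.Msz`, one `(β, δ, m₀)` for the five backward families at every sized index
  (plain coarse∕fine `∇⁻_μG`, plain coarse `∇⁻_μG∂_{j.ν}*`, the two η-defects at `m₀·θ_j·e^{−δd}`, `θ_j = (L^k)^{−¼}`).

HONEST FRAMING ∕ LIMITS.  `U = 1` LINEAR theory on FINITE tori, `d + 1 ≥ 2`, ONE single-scale piece in King's (4.42) shape; the new analytic input is b05's
decaying Hölder bound of `∂_νH_k` (Bałaban's (1.63) sentence), everything else is LANDED forward-piece theorems moved one block; the exponent bookkeeping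
(`⅓`, `min(α,γ) ≤ ⅔`) is ours, NOT printed; NOT [B6]'s multiscale carrier ∕ NODE 00; nothing with background (NE2⁺ proper NOT PRINTED ∕ not proved).
Count-neutral (typed 28∕28 · discharged unchanged); NOT a discharge of N15; one finite T⁴ at fixed ε — NOT infinite volume, NOT OS on ℝ⁴, NOT a mass gap, NOT Clay.
-/

noncomputable section

open scoped BigOperators
open Finset

namespace Summit.QuantumFields.YangMills.BalabanUVNodes.N15.VectorPiece

open Literature.MathematicalPhysics.QuantumFieldTheory.Balaban1983to89
open Literature.MathematicalPhysics.QuantumFieldTheory.Balaban1983to89.B11SectG (BlockNorm HasMaj)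
open Literature.MathematicalPhysics.QuantumFieldTheory.Balaban1983to89.T4EtaRateDefect (idef idef_comp)
open Literature.MathematicalPhysics.QuantumFieldTheory.Balaban1983to89.T4EtaRateCoeffDefect (pull)
open Literature.MathematicalPhysics.QuantumFieldTheory.Balaban1983to89.B4TorusKernel (periodConst)
open Literature.MathematicalPhysics.QuantumFieldTheory.Balaban1983to89.B5Prop11Plancherel (Tor fine unitVec)
open Literature.MathematicalPhysics.QuantumFieldTheory.Balaban1983to89.B5Hk163Strip (kappa163 kappa163_pos)
open Literature.MathematicalPhysics.QuantumFieldTheory.Balaban1983to89.B5Hk163Decay (MG163)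
open Literature.MathematicalPhysics.QuantumFieldTheory.Balaban1983to89.B5Hk163TorusHolderDecay (MD163 CHD)
open Literature.MathematicalPhysics.QuantumFieldTheory.Balaban1983to89.B6UnitTorusCarrier (unitTorusGeo unitTorusGeo_dist)
open Literature.MathematicalPhysics.QuantumFieldTheory.King1986.Torus (blockOf tdistT tdistT_nonneg tdistT_symm tdistT_triangle)
open Summit.QuantumFields.YangMills.BalabanUVNodes.N15.DefectKernel (abs_reD_single_sub_bshift_le CHD_third_nonneg exp_neg_min_le)

variable {d : ℕ}

/-! ## §1 The plain majorants of the backward pieces -/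

section Plain

variable {L : ℕ} [NeZero L]

/-- **THE PLAIN MAJORANTS OF THE BACKWARD PIECES, ONE UNIFORM `(β, δ_p)`.**  For `d + 1 ≥ 2`, `L ≥ 1` there are `β, δ_p > 0` such that for every unit torus
`Π ℤ∕M_ν` with `L ∣ M_ν`, all `k, m, μ, ν` and `0 ≤ ρ ≤ δ_p`: the coarse `∇⁻_μG` (blocks `blkFine`), the fine `∇⁻′_μG′` (blocks `blkFine ∘ kingPrV`) and the coarse
`∇⁻_μG∂_ν*` have the block majorant `β·e^{−ρ|y−y′|_T}` — the landed forward majorants (`hasMaj_plainMixed_all`, `hasMaj_plain_all`) moved one unit block by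
`hasMaj_bshiftV_comp`. [cite: Balaban1984PropagatorsII, (2.52)–(2.55) pp.232–233 (block-majorant bookkeeping); King1986, (4.42) p.675 (the piece)] -/
theorem hasMaj_plainBackward_all (hd : 1 ≤ d) (hL : 1 ≤ L) :
    ∃ β δp : ℝ, 0 < β ∧ 0 < δp ∧ ∀ (M : Fin (d + 1) → ℕ) [∀ μ, NeZero (M μ)] (_ : ∀ i, L ∣ M i) (k m : ℕ) (μ ν : Fin (d + 1))
      {ρ : ℝ} (_ : 0 ≤ ρ) (_ : ρ ≤ δp),
      HasMaj (BlockNorm.ofBlocks (unitTorusGeo L k M) (blkFine L k M)) (BlockNorm.ofBlocks (unitTorusGeo L k M) (blkFine L k M))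
          (pieceD1b L M (L ^ k) k (rweight (d := d) L k) μ) (fun y y' => β * Real.exp (-(ρ * tdistT M y y')))
      ∧ HasMaj (BlockNorm.ofBlocks (unitTorusGeo L k M) (blkFine L k M ∘ kingPrV L k m M))
          (BlockNorm.ofBlocks (unitTorusGeo L k M) (blkFine L k M ∘ kingPrV L k m M))
          (pieceD1b L M (L ^ m * L ^ k) (k + m) (rweight (d := d) L k / ((L : ℝ) ^ m) ^ (d + 1)) μ)
          (fun y y' => β * Real.exp (-(ρ * tdistT M y y')))
      ∧ HasMaj (BlockNorm.ofBlocks (unitTorusGeo L k M) (blkFine L k M)) (BlockNorm.ofBlocks (unitTorusGeo L k M) (blkFine L k M))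
          (pieceMb L M (L ^ k) k (rweight (d := d) L k) μ ν) (fun y y' => β * Real.exp (-(ρ * tdistT M y y'))) := by
  obtain ⟨βq, δq, hβq, hδq, HQ⟩ := hasMaj_plainMixed_all (d := d) (L := L) hd hL
  obtain ⟨βp, δp, hβp, hδp, HP⟩ := hasMaj_plain_all (d := d) (L := L) hd hL
  refine ⟨max βq βp * Real.exp (min δq δp), min δq δp, by positivity, lt_min hδq hδp, fun M _ hLM k m μ ν ρ hρ hρδ => ?_⟩
  have hρq : ρ ≤ δq := hρδ.trans (min_le_left _ _)
  have hρp : ρ ≤ δp := hρδ.trans (min_le_right _ _)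
  have hmax : 0 ≤ max βq βp := hβq.le.trans (le_max_left _ _)
  -- weakening the shifted majorant `β'·e^{ρ}·e^{−ρd}` to the common letters
  have hw : ∀ {β' : ℝ}, β' ≤ max βq βp → ∀ y y' : Tor M,
      β' * Real.exp ρ * Real.exp (-(ρ * tdistT M y y')) ≤ max βq βp * Real.exp (min δq δp) * Real.exp (-(ρ * tdistT M y y')) :=
    fun hle y y' => mul_le_mul_of_nonneg_right (mul_le_mul hle (Real.exp_le_exp.mpr hρδ) (Real.exp_nonneg _) hmax) (Real.exp_nonneg _)
  have hfine : blkFine L k M ∘ kingPrV L k m M = fun i' : Tor (fine (L ^ m * L ^ k) M) × Fin (d + 1) => blockOf (L ^ m * L ^ k) M i'.1 :=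
    blkFine_comp_kingPrV M L k m
  refine ⟨?_, ?_, ?_⟩
  · exact (hasMaj_bshiftV_comp M k (L ^ k) hβq.le hρ μ (HQ M hLM k m μ ν hρ hρq).1).mono (hw (le_max_left _ _))
  · have h := (HP M hLM k m μ hρ hρp).2.2.2.1
    rw [hfine] at h ⊢
    exact (hasMaj_bshiftV_comp M k (L ^ m * L ^ k) hβp.le hρ μ h).mono (hw (le_max_right _ _))
  · exact (hasMaj_bshiftV_comp M k (L ^ k) hβq.le hρ μ (HQ M hLM k m μ ν hρ hρq).2.1).mono (hw (le_max_left _ _))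

end Plain

/-! ## §2 The η-defects of the backward pieces through King's pairing -/

section Defect

variable {L : ℕ} [NeZero L]

omit [NeZero L] in
/-- THE HÖLDER STEP's RATE IS ABSORBED: `(1∕L^k)^{⅓} ≤ (L^k)^{−r}` for `r ≤ ⅓`, `L ≥ 1`. [folklore] -/
theorem one_div_rpow_third_le (hL : 1 ≤ L) (k : ℕ) {r : ℝ} (hr : r ≤ 1 / 3) :
    (1 / ((L : ℝ) ^ k)) ^ (1 / 3 : ℝ) ≤ ((L : ℝ) ^ k) ^ (-r) := by
  have hx : (1 : ℝ) ≤ (L : ℝ) ^ k := one_le_pow₀ (by exact_mod_cast hL)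
  have hx0 : (0 : ℝ) ≤ (L : ℝ) ^ k := zero_le_one.trans hx
  rw [one_div, Real.inv_rpow hx0, ← Real.rpow_neg hx0]
  exact Real.rpow_le_rpow_of_exponent_le hx (by linarith)

omit [NeZero L] in
/-- THE TWO TERMS ADD UP UNDER THE COMMON LETTERS: `B₁·x·e_ρ·E + C·t·E ≤ B·x·E` when `e_ρ ≤ e_δ`, `t ≤ x` and `B₁e_δ + C ≤ B` (all letters `≥ 0`). [folklore] -/
theorem backward_sum_le {B₁ B C x t E eρ eδ : ℝ} (hB₁ : 0 ≤ B₁) (hC : 0 ≤ C) (hx : 0 ≤ x) (htx : t ≤ x) (hE : 0 ≤ E)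
    (he : eρ ≤ eδ) (hB : B₁ * eδ + C ≤ B) : B₁ * x * eρ * E + C * t * E ≤ B * x * E := by
  have h1 : B₁ * x * eρ * E ≤ B₁ * x * eδ * E :=
    mul_le_mul_of_nonneg_right (mul_le_mul_of_nonneg_left he (mul_nonneg hB₁ hx)) hE
  have h2 : C * t * E ≤ C * x * E := mul_le_mul_of_nonneg_right (mul_le_mul_of_nonneg_left htx hC) hE
  have h3 : B₁ * x * eδ * E + C * x * E = (B₁ * eδ + C) * x * E := by ring
  have h4 : (B₁ * eδ + C) * x * E ≤ B * x * E := mul_le_mul_of_nonneg_right (mul_le_mul_of_nonneg_right hB hx) hE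
  linarith

/-- **THE η-DEFECTS OF THE BACKWARD PIECES THROUGH KING's PAIRING, ONE SET OF CONSTANTS.**  For `d + 1 ≥ 2`, `L ≥ 1`, `0 ≤ α < 1`, `0 < γ < 1` with
`min(α,γ) ≤ ⅔` there are `B, δ₀ > 0` such that for every unit torus `Π ℤ∕M_ν` with `L ∣ M_ν`, all `k`, `m ≥ 1`, `μ, ν`, `0 ≤ ρ ≤ δ₀`: the η-defects
`𝔇(∇⁻′_μG′, ∇⁻_μG)` and `𝔇(∇⁻′_μG′∂′_ν*, ∇⁻_μG∂_ν*)` of the backward derived and backward mixed pieces through King's bond pairing have the block majorant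
`B·(L^k)^{−min(α,γ)∕2}·e^{−ρ|y−y′|_T}` between the sharp cube norms of `blkFine` and `blkFine ∘ kingPrV`.  Mechanism: `𝔇(S′P′, SP) = S′∘𝔇(P′,P) + 𝔇(S′,S)∘P`;
first term = the landed forward entry moved one block (`hasMaj_bshiftV_comp`); second term ≤ the plain majorant of `((1 − S_{−μ})∂_μH_k)·C^{(k)}·(w·Bᵀ)`
(`hasMaj_idefShift_comp` + `hasMaj_plain_unitTorus`) whose left factor is Hölder-small with decay (`abs_reD_single_sub_bshift_le`: `CHD(d,⅓)(L^k)^{−⅓}e^{δ_H∕2}`).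
[cite: King1986, Prop. 3.8 (3.71) p.664 (second line, shape), (4.42)–(4.43) p.675; Balaban1984PropagatorsI, (1.63) p.28, p.29 l.1–2 (the Hölder sentence); Balaban1985BackgroundPropagators, (3.42) p.397, (3.44) p.398, (3.52) p.400 (shapes)] -/
theorem hasMaj_backwardEntries (hd : 1 ≤ d) (hL : 1 ≤ L) {α γ : ℝ} (hα0 : 0 ≤ α) (hα1 : α < 1) (hγ0 : 0 < γ) (hγ1 : γ < 1)
    (hαγ : min α γ ≤ 2 / 3) :
    ∃ B δ₀ : ℝ, 0 < B ∧ 0 < δ₀ ∧ ∀ (M : Fin (d + 1) → ℕ) [∀ μ, NeZero (M μ)] (_ : ∀ i, L ∣ M i) (k m : ℕ) (_ : 1 ≤ m)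
      (μ ν : Fin (d + 1)) {ρ : ℝ} (_ : 0 ≤ ρ) (_ : ρ ≤ δ₀),
      HasMaj (BlockNorm.ofBlocks (unitTorusGeo L k M) (blkFine L k M))
          (BlockNorm.ofBlocks (unitTorusGeo L k M) (blkFine L k M ∘ kingPrV L k m M))
          (idef (pull (kingPrV L k m M)) (pull (kingPrV L k m M))
            (pieceD1b L M (L ^ m * L ^ k) (k + m) (rweight (d := d) L k / ((L : ℝ) ^ m) ^ (d + 1)) μ)
            (pieceD1b L M (L ^ k) k (rweight (d := d) L k) μ))
          (fun y y' => B * ((L : ℝ) ^ k) ^ (-(min α γ / 2)) * Real.exp (-(ρ * tdistT M y y')))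
      ∧ HasMaj (BlockNorm.ofBlocks (unitTorusGeo L k M) (blkFine L k M))
          (BlockNorm.ofBlocks (unitTorusGeo L k M) (blkFine L k M ∘ kingPrV L k m M))
          (idef (pull (kingPrV L k m M)) (pull (kingPrV L k m M))
            (pieceMb L M (L ^ m * L ^ k) (k + m) (rweight (d := d) L k / ((L : ℝ) ^ m) ^ (d + 1)) μ ν)
            (pieceMb L M (L ^ k) k (rweight (d := d) L k) μ ν))
          (fun y y' => B * ((L : ℝ) ^ k) ^ (-(min α γ / 2)) * Real.exp (-(ρ * tdistT M y y'))) := by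
  obtain ⟨B₁, δ₁, hB₁, hδ₁, H1⟩ := hasMaj_threeEntries (d := d) (L := L) hd hL hα0 hα1 hγ0 hγ1
  obtain ⟨B₄, δ₄, hB₄, hδ₄, H4⟩ := hasMaj_mixedEntries (d := d) (L := L) hd hL hα0 hα1 hγ0 hγ1
  obtain ⟨B₀, δ₀, hB₀, hδ₀, HC⟩ := exists_abs_covC_single_le (d := d) hd hL
  have hL0 : L ≠ 0 := by omega
  have hpC : 0 < periodConst (kappa163 (d + 1)) d := B5Kernel166Decay.periodConst_pos (kappa163_pos _) d
  have hMG : 0 ≤ MG163 (d + 1) := B5Hk163Decay.MG163_nonneg _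
  have hMD : 0 ≤ MD163 (d + 1) := (mul_nonneg_iff_of_pos_right hpC).mp (B5Hk163TorusHolderDecay.CdecD_nonneg (d := d))
  have hδH : 0 < kappa163 (d + 1) / (d + 1) := div_pos (kappa163_pos _) (by positivity)
  have hr3 : min α γ / 2 ≤ 1 / 3 := by linarith
  -- the constants: kernel constants, the (2.61) window `σ`, the Hölder left-factor constant `aH`, the term-B constant `CB b₀`
  set c₀ : ℝ := MG163 (d + 1) * periodConst (kappa163 (d + 1)) d with hc₀
  set cD : ℝ := MD163 (d + 1) * periodConst (kappa163 (d + 1)) d with hcD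
  have hc₀0 : 0 ≤ c₀ := mul_nonneg hMG hpC.le
  have hcD0 : 0 ≤ cD := mul_nonneg hMD hpC.le
  set σ : ℝ := min (kappa163 (d + 1) / (d + 1) / 2) δ₀ / 2 with hσ
  have hσ0 : 0 < σ := half_pos (lt_min (half_pos hδH) hδ₀)
  set Kσ : ℝ := B4Sect5Proof.latticeConst (d + 1) σ with hKσ
  have hKσ0 : 0 ≤ Kσ := B4Sect5Proof.latticeConst_nonneg (d + 1) hσ0.le
  set aH : ℝ := CHD d (1 / 3 : ℝ) * Real.exp (kappa163 (d + 1) / (d + 1) / 2) with haH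
  have haH0 : 0 ≤ aH := mul_nonneg CHD_third_nonneg (Real.exp_nonneg _)
  set CB : ℝ → ℝ := fun b₀ => (((d + 1 : ℕ) : ℝ) * aH * Kσ) * ((((d + 1 : ℕ) : ℝ) * B₀ * Kσ) * (((d + 1 : ℕ) : ℝ) * b₀)) with hCB
  have hCB0 : ∀ {b₀ : ℝ}, 0 ≤ b₀ → 0 ≤ CB b₀ := fun hb => by positivity
  set δs : ℝ := min σ (min δ₁ δ₄) with hδs
  have hδs0 : 0 < δs := lt_min hσ0 (lt_min hδ₁ hδ₄)
  set B : ℝ := (B₁ + B₄) * Real.exp δs + CB c₀ + CB cD + 1 with hB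
  have hBpos : 0 < B := by
    have := hCB0 hc₀0; have := hCB0 hcD0; positivity
  refine ⟨B, δs, hBpos, hδs0, fun M _ hLM k m hm μ ν ρ hρ hρδ => ?_⟩
  have hρσ : ρ ≤ σ := hρδ.trans (min_le_left _ _)
  have hρ1 : ρ ≤ δ₁ := hρδ.trans ((min_le_right _ _).trans (min_le_left _ _))
  have hρ4 : ρ ≤ δ₄ := hρδ.trans ((min_le_right _ _).trans (min_le_right _ _))
  have h2σ : ρ + σ ≤ min (kappa163 (d + 1) / (d + 1) / 2) δ₀ := by rw [hσ] at hρσ ⊢; linarith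
  have hρA : ρ + σ ≤ kappa163 (d + 1) / (d + 1) / 2 := h2σ.trans (min_le_left _ _)
  have hρB : ρ + σ ≤ kappa163 (d + 1) / (d + 1) := hρA.trans (by linarith)
  have hρC : ρ + σ ≤ δ₀ := h2σ.trans (min_le_right _ _)
  have hx0 : (0 : ℝ) < (L : ℝ) ^ k := pow_pos (by exact_mod_cast (show 0 < L by omega)) _
  have hxr : 0 ≤ ((L : ℝ) ^ k) ^ (-(min α γ / 2)) := Real.rpow_nonneg hx0.le _
  have ht0 : 0 ≤ (1 / ((L : ℝ) ^ k)) ^ (1 / 3 : ℝ) := Real.rpow_nonneg (by positivity) _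
  have htx : (1 / ((L : ℝ) ^ k)) ^ (1 / 3 : ℝ) ≤ ((L : ℝ) ^ k) ^ (-(min α γ / 2)) := one_div_rpow_third_le hL k hr3
  have hcast : ((L ^ k : ℕ) : ℝ) = (L : ℝ) ^ k := by push_cast; ring
  have heρδ : Real.exp ρ ≤ Real.exp δs := Real.exp_le_exp.mpr hρδ
  -- TERM B: `𝔇(S′_{−μ}, S_{−μ})∘(∂_μH·C·(w·Bᵀ))` for any right factor `B` with entries `≤ b₀·e^{−δ_H d}`
  have termB : ∀ {Bf : (Tor M × Fin (d + 1) → ℝ) →ₗ[ℝ] (Tor (fine (L ^ k) M) × Fin (d + 1) → ℝ)} {b₀ : ℝ} (_ : 0 ≤ b₀)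
      (_ : ∀ (b : Tor M × Fin (d + 1)) (i : Tor (fine (L ^ k) M) × Fin (d + 1)),
        |Bf (Pi.single b 1) i| ≤ b₀ * Real.exp (-(kappa163 (d + 1) / (d + 1) * tdistT M (blockOf (L ^ k) M i.1) b.1))),
      HasMaj (BlockNorm.ofBlocks (unitTorusGeo L k M) (blkFine L k M)) (BlockNorm.ofBlocks (unitTorusGeo L k M) (blkFine L k M ∘ kingPrV L k m M))
        (idef (pull (kingPrV L k m M)) (pull (kingPrV L k m M)) (bshiftV M (L ^ m * L ^ k) μ) (bshiftV M (L ^ k) μ) ∘ₗ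
          (reD M (L ^ k) μ ∘ₗ (covC L M (L ^ k) ∘ₗ wTranspose M (L ^ k) (rweight (d := d) L k) Bf)))
        (fun y y' => CB b₀ * (1 / ((L : ℝ) ^ k)) ^ (1 / 3 : ℝ) * Real.exp (-(ρ * tdistT M y y'))) := by
    intro Bf b₀ hb hBf
    refine hasMaj_idefShift_comp M k m (fun _ _ => mul_nonneg (mul_nonneg (hCB0 hb) ht0) (Real.exp_nonneg _)) μ ?_
    rw [← LinearMap.comp_assoc]
    -- the left factor `(1 − S_{−μ})∂_μH_k`: Hölder-small with decay from the block of the base point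
    have hA : ∀ (b : Tor M × Fin (d + 1)) (i : Tor (fine (L ^ k) M) × Fin (d + 1)),
        |(((LinearMap.id : (Tor (fine (L ^ k) M) × Fin (d + 1) → ℝ) →ₗ[ℝ] (Tor (fine (L ^ k) M) × Fin (d + 1) → ℝ)) - bshiftV M (L ^ k) μ) ∘ₗ reD M (L ^ k) μ) (Pi.single b 1) i| ≤
          aH * (1 / ((L : ℝ) ^ k)) ^ (1 / 3 : ℝ) * Real.exp (-(kappa163 (d + 1) / (d + 1) / 2 * tdistT M (blockOf (L ^ k) M i.1) b.1)) := by
      intro b i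
      have hstep : (((LinearMap.id : (Tor (fine (L ^ k) M) × Fin (d + 1) → ℝ) →ₗ[ℝ] (Tor (fine (L ^ k) M) × Fin (d + 1) → ℝ)) - bshiftV M (L ^ k) μ) ∘ₗ reD M (L ^ k) μ) (Pi.single b 1) i =
          reD M (L ^ k) μ (Pi.single b 1) i - reD M (L ^ k) μ (Pi.single b 1) (i.1 - unitVec (fine (L ^ k) M) μ, i.2) := rfl
      rw [hstep]
      refine (abs_reD_single_sub_bshift_le (L ^ k) M μ μ b i).trans ?_
      rw [hcast]
      have htri := tdistT_triangle M (blockOf (L ^ k) M i.1) (blockOf (L ^ k) M (i.1 - unitVec (fine (L ^ k) M) μ)) b.1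
      have hone : tdistT M (blockOf (L ^ k) M i.1) (blockOf (L ^ k) M (i.1 - unitVec (fine (L ^ k) M) μ)) ≤ 1 := by
        rw [tdistT_symm]; exact tdistT_blockOf_sub_unitVec_le (L ^ k) M i.1 μ
      have hmin := exp_neg_min_le (δ := kappa163 (d + 1) / (d + 1) / 2) (t := 1) (d₀ := tdistT M (blockOf (L ^ k) M i.1) b.1)
        (d₁ := tdistT M (blockOf (L ^ k) M i.1) b.1) (d₂ := tdistT M (blockOf (L ^ k) M (i.1 - unitVec (fine (L ^ k) M) μ)) b.1)
        (half_pos hδH).le (by linarith) (by linarith)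
      rw [mul_one] at hmin
      calc CHD d (1 / 3 : ℝ) * (1 / (L : ℝ) ^ k) ^ (1 / 3 : ℝ) *
            Real.exp (-(kappa163 (d + 1) / (d + 1) / 2 *
              min (tdistT M (blockOf (L ^ k) M i.1) b.1) (tdistT M (blockOf (L ^ k) M (i.1 - unitVec (fine (L ^ k) M) μ)) b.1)))
          ≤ CHD d (1 / 3 : ℝ) * (1 / (L : ℝ) ^ k) ^ (1 / 3 : ℝ) * (Real.exp (kappa163 (d + 1) / (d + 1) / 2) *
              Real.exp (-(kappa163 (d + 1) / (d + 1) / 2 * tdistT M (blockOf (L ^ k) M i.1) b.1))) :=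
            mul_le_mul_of_nonneg_left hmin (mul_nonneg CHD_third_nonneg ht0)
        _ = aH * (1 / ((L : ℝ) ^ k)) ^ (1 / 3 : ℝ) * Real.exp (-(kappa163 (d + 1) / (d + 1) / 2 * tdistT M (blockOf (L ^ k) M i.1) b.1)) := by
            rw [haH]; ring
    have key := hasMaj_plain_unitTorus (L := L) M k k (L ^ k) hB₀.le (fun b b' => HC M hLM k b b') (mul_nonneg haH0 ht0) hb hA hBf
      (rweight_nonneg (d := d) L k) (fineBond_weight_balance hL0 k) hσ0 hρ hρA hρB hρC
    refine key.mono fun y y' => le_of_eq ?_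
    rw [hCB]
    ring
  -- the comparison of the two terms' sum with the common letters
  have hsum : ∀ {BA b₀ : ℝ}, 0 ≤ BA → 0 ≤ b₀ → BA * Real.exp δs + CB b₀ ≤ B → ∀ y y' : Tor M,
      BA * ((L : ℝ) ^ k) ^ (-(min α γ / 2)) * Real.exp ρ * Real.exp (-(ρ * tdistT M y y')) +
          CB b₀ * (1 / ((L : ℝ) ^ k)) ^ (1 / 3 : ℝ) * Real.exp (-(ρ * tdistT M y y'))
        ≤ B * ((L : ℝ) ^ k) ^ (-(min α γ / 2)) * Real.exp (-(ρ * tdistT M y y')) := fun hBA hb hle y y' =>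
    backward_sum_le hBA (hCB0 hb) hxr htx (Real.exp_nonneg _) heρδ hle
  have hB1le : B₁ * Real.exp δs + CB c₀ ≤ B := by
    rw [hB]; linarith [mul_nonneg hB₄.le (Real.exp_nonneg δs), hCB0 hcD0]
  have hB4le : B₄ * Real.exp δs + CB cD ≤ B := by
    rw [hB]; linarith [mul_nonneg hB₁.le (Real.exp_nonneg δs), hCB0 hc₀0]
  have hfine : blkFine L k M ∘ kingPrV L k m M = fun i' : Tor (fine (L ^ m * L ^ k) M) × Fin (d + 1) => blockOf (L ^ m * L ^ k) M i'.1 :=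
    blkFine_comp_kingPrV M L k m
  refine ⟨?_, ?_⟩
  · -- the backward derived piece: TERM A = the landed entry 1 moved one block
    have h1 : HasMaj (BlockNorm.ofBlocks (unitTorusGeo L k M) (blkFine L k M))
        (BlockNorm.ofBlocks (unitTorusGeo L k M) (blkFine L k M ∘ kingPrV L k m M)) (entry1 (d := d) L k m M μ)
        (fun y y' => B₁ * ((L : ℝ) ^ k) ^ (-(min α γ / 2)) * Real.exp (-(ρ * tdistT M y y'))) :=
      (H1 M hLM k m hm μ).2.1.mono fun y y' => mul_le_mul_of_nonneg_left
        (Real.exp_le_exp.mpr (neg_le_neg (mul_le_mul_of_nonneg_right hρ1 (tdistT_nonneg _ _ _)))) (mul_nonneg hB₁.le hxr)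
    rw [hfine] at h1
    have hA := hasMaj_bshiftV_comp M k (L ^ m * L ^ k) (mul_nonneg hB₁.le hxr) hρ μ h1
    have hBt := termB hc₀0 (fun b i => abs_reH_single_le M (L ^ k) b i)
    rw [hfine] at hBt
    have htot := hA.add hBt
    have hop : idef (pull (kingPrV L k m M)) (pull (kingPrV L k m M))
        (pieceD1b L M (L ^ m * L ^ k) (k + m) (rweight (d := d) L k / ((L : ℝ) ^ m) ^ (d + 1)) μ) (pieceD1b L M (L ^ k) k (rweight (d := d) L k) μ) =
        bshiftV M (L ^ m * L ^ k) μ ∘ₗ entry1 (d := d) L k m M μ +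
          idef (pull (kingPrV L k m M)) (pull (kingPrV L k m M)) (bshiftV M (L ^ m * L ^ k) μ) (bshiftV M (L ^ k) μ) ∘ₗ
            (reD M (L ^ k) μ ∘ₗ (covC L M (L ^ k) ∘ₗ wTranspose M (L ^ k) (rweight (d := d) L k) (reH M (L ^ k)))) := by
      have h := idef_comp (pull (kingPrV L k m M)) (pull (kingPrV L k m M)) (pull (kingPrV L k m M)) (bshiftV M (L ^ m * L ^ k) μ)
        (pieceD1 L M (L ^ m * L ^ k) (k + m) (rweight (d := d) L k / ((L : ℝ) ^ m) ^ (d + 1)) μ) (bshiftV M (L ^ k) μ)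
        (pieceD1 L M (L ^ k) k (rweight (d := d) L k) μ)
      rw [← entry1_eq_idef] at h
      exact h
    rw [hfine]
    rw [hop]
    exact htot.mono (hsum hB₁.le hc₀0 hB1le)
  · -- the backward mixed piece: TERM A = g0's mixed pair moved one block
    have h4 := H4 M hLM k m hm μ ν hρ hρ4
    rw [hfine] at h4
    have hA := hasMaj_bshiftV_comp M k (L ^ m * L ^ k) (mul_nonneg hB₄.le hxr) hρ μ h4
    have hBt := termB hcD0 (fun b i => abs_reD_single_le M (L ^ k) ν b i)
    rw [hfine] at hBt
    have htot := hA.add hBt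
    have hop : idef (pull (kingPrV L k m M)) (pull (kingPrV L k m M))
        (pieceMb L M (L ^ m * L ^ k) (k + m) (rweight (d := d) L k / ((L : ℝ) ^ m) ^ (d + 1)) μ ν) (pieceMb L M (L ^ k) k (rweight (d := d) L k) μ ν) =
        bshiftV M (L ^ m * L ^ k) μ ∘ₗ idef (pull (kingPrV L k m M)) (pull (kingPrV L k m M))
            (reD M (L ^ m * L ^ k) μ ∘ₗ (covC L M (L ^ (k + m)) ∘ₗ
              wTranspose M (L ^ m * L ^ k) (rweight (d := d) L k / ((L : ℝ) ^ m) ^ (d + 1)) (reD M (L ^ m * L ^ k) ν)))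
            (reD M (L ^ k) μ ∘ₗ (covC L M (L ^ k) ∘ₗ wTranspose M (L ^ k) (rweight (d := d) L k) (reD M (L ^ k) ν))) +
          idef (pull (kingPrV L k m M)) (pull (kingPrV L k m M)) (bshiftV M (L ^ m * L ^ k) μ) (bshiftV M (L ^ k) μ) ∘ₗ
            (reD M (L ^ k) μ ∘ₗ (covC L M (L ^ k) ∘ₗ wTranspose M (L ^ k) (rweight (d := d) L k) (reD M (L ^ k) ν))) :=
      idef_comp (pull (kingPrV L k m M)) (pull (kingPrV L k m M)) (pull (kingPrV L k m M)) (bshiftV M (L ^ m * L ^ k) μ)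
        (pieceM L M (L ^ m * L ^ k) (k + m) (rweight (d := d) L k / ((L : ℝ) ^ m) ^ (d + 1)) μ ν) (bshiftV M (L ^ k) μ)
        (pieceM L M (L ^ k) k (rweight (d := d) L k) μ ν)
    rw [hfine]
    rw [hop]
    exact htot.mono (hsum hB₄.le hcD0 hB4le)

end Defect

/-! ## §3 The backward layer at ONE uniform `(β, δ, m₀)`, on the sized carriers -/

section Layer

variable {L : ℕ} [NeZero L]

/-- **THE UNIFORM U ≡ 1 LAYER OF THE BACKWARD PIECES.**  For `d + 1 ≥ 2`, `L ≥ 1` there are `β, δ, m₀ > 0` such that at every sized index `j` (source direction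
`ν = j.ν`): the plain majorants `β·e^{−δ|y−y′|_T}` of `∇⁻_μG` (coarse, all `μ`), `∇⁻′_μG′` (fine, all `μ`), `∇⁻_μG∂_ν*` (coarse, all `μ`) and the η-defects
`m₀·θ_j·e^{−δ|y−y′|_T}` of `(∇⁻′_μG′, ∇⁻_μG)`, `(∇⁻′_μG′∂′_ν*, ∇⁻_μG∂_ν*)` (all `μ`; §2 read at `α = γ = ½`, `θ_j = (L^k)^{−¼}`) hold on the sized carrier — the
`inr` half of the forward∕backward stack that `ne2PlusOperator_v1` displays. [cite: King1986, (4.42)–(4.43) p.675 (mechanism); Balaban1985BackgroundPropagators, (3.42) p.397, (3.44) p.398, (3.52) p.400 (shapes)] -/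
theorem uniform_layer_backward (hd : 1 ≤ d) (hL : 1 ≤ L) :
    ∃ β δ m₀ : ℝ, 0 < β ∧ 0 < δ ∧ 0 < m₀ ∧ ∀ j : VecIndexS d L,
      (∀ μ, HasMaj (BlockNorm.ofBlocks (unitTorusGeoS L j.k j.Mn j.Msz) (blkFine L j.k j.Mn))
          (BlockNorm.ofBlocks (unitTorusGeoS L j.k j.Mn j.Msz) (blkFine L j.k j.Mn))
          (pieceD1b L j.Mn (L ^ j.k) j.k (rweight (d := d) L j.k) μ) (fun y y' => β * Real.exp (-(δ * (unitTorusGeoS L j.k j.Mn j.Msz).dist y y'))))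
      ∧ (∀ μ, HasMaj (BlockNorm.ofBlocks (unitTorusGeoS L j.k j.Mn j.Msz) (blkFine L j.k j.Mn ∘ kingPrV L j.k j.m j.Mn))
          (BlockNorm.ofBlocks (unitTorusGeoS L j.k j.Mn j.Msz) (blkFine L j.k j.Mn ∘ kingPrV L j.k j.m j.Mn))
          (pieceD1b L j.Mn (L ^ j.m * L ^ j.k) (j.k + j.m) (rweight (d := d) L j.k / ((L : ℝ) ^ j.m) ^ (d + 1)) μ)
          (fun y y' => β * Real.exp (-(δ * (unitTorusGeoS L j.k j.Mn j.Msz).dist y y'))))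
      ∧ (∀ μ, HasMaj (BlockNorm.ofBlocks (unitTorusGeoS L j.k j.Mn j.Msz) (blkFine L j.k j.Mn))
          (BlockNorm.ofBlocks (unitTorusGeoS L j.k j.Mn j.Msz) (blkFine L j.k j.Mn))
          (pieceMb L j.Mn (L ^ j.k) j.k (rweight (d := d) L j.k) μ j.ν) (fun y y' => β * Real.exp (-(δ * (unitTorusGeoS L j.k j.Mn j.Msz).dist y y'))))
      ∧ (∀ μ, HasMaj (BlockNorm.ofBlocks (unitTorusGeoS L j.k j.Mn j.Msz) (blkFine L j.k j.Mn))
          (BlockNorm.ofBlocks (unitTorusGeoS L j.k j.Mn j.Msz) (blkFine L j.k j.Mn ∘ kingPrV L j.k j.m j.Mn))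
          (idef (pull (kingPrV L j.k j.m j.Mn)) (pull (kingPrV L j.k j.m j.Mn))
            (pieceD1b L j.Mn (L ^ j.m * L ^ j.k) (j.k + j.m) (rweight (d := d) L j.k / ((L : ℝ) ^ j.m) ^ (d + 1)) μ)
            (pieceD1b L j.Mn (L ^ j.k) j.k (rweight (d := d) L j.k) μ))
          (fun y y' => m₀ * thetaV L j * Real.exp (-(δ * (unitTorusGeoS L j.k j.Mn j.Msz).dist y y'))))
      ∧ (∀ μ, HasMaj (BlockNorm.ofBlocks (unitTorusGeoS L j.k j.Mn j.Msz) (blkFine L j.k j.Mn))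
          (BlockNorm.ofBlocks (unitTorusGeoS L j.k j.Mn j.Msz) (blkFine L j.k j.Mn ∘ kingPrV L j.k j.m j.Mn))
          (idef (pull (kingPrV L j.k j.m j.Mn)) (pull (kingPrV L j.k j.m j.Mn))
            (pieceMb L j.Mn (L ^ j.m * L ^ j.k) (j.k + j.m) (rweight (d := d) L j.k / ((L : ℝ) ^ j.m) ^ (d + 1)) μ j.ν)
            (pieceMb L j.Mn (L ^ j.k) j.k (rweight (d := d) L j.k) μ j.ν))
          (fun y y' => m₀ * thetaV L j * Real.exp (-(δ * (unitTorusGeoS L j.k j.Mn j.Msz).dist y y')))) := by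
  obtain ⟨βb, δb, hβb, hδb, HB⟩ := hasMaj_plainBackward_all (d := d) (L := L) hd hL
  obtain ⟨B₅, δ₅, hB₅, hδ₅, H5⟩ := hasMaj_backwardEntries (d := d) (L := L) hd hL (α := 1 / 2) (γ := 1 / 2) (by norm_num) (by norm_num) (by norm_num)
    (by norm_num) (by norm_num)
  have hmin : min (1 / 2 : ℝ) (1 / 2) / 2 = 1 / 4 := by norm_num
  rw [hmin] at H5
  refine ⟨βb, min δb δ₅, B₅, hβb, lt_min hδb hδ₅, hB₅, fun j => ?_⟩
  have hδb' : min δb δ₅ ≤ δb := min_le_left _ _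
  have hδ₅' : min δb δ₅ ≤ δ₅ := min_le_right _ _
  have hδ0 : 0 ≤ min δb δ₅ := (lt_min hδb hδ₅).le
  refine ⟨fun μ => (HB j.Mn j.dvd j.k j.m μ j.ν hδ0 hδb').1, fun μ => (HB j.Mn j.dvd j.k j.m μ j.ν hδ0 hδb').2.1,
    fun μ => (HB j.Mn j.dvd j.k j.m μ j.ν hδ0 hδb').2.2, fun μ => (H5 j.Mn j.dvd j.k j.m j.one_le μ j.ν hδ0 hδ₅').1,
    fun μ => (H5 j.Mn j.dvd j.k j.m j.one_le μ j.ν hδ0 hδ₅').2⟩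

end Layer

end Summit.QuantumFields.YangMills.BalabanUVNodes.N15.VectorPiece

end
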